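import Literature.Geometry.Riemannian.BochnerRicciInequality
import Literature.Geometry.Riemannian.EigenvaluePinchingSphereMoserProofs
import Literature.Geometry.Lorentzian.GreenIdentityCompactSupport
import Literature.Geometry.Lorentzian.MassCapacityHarmonic
import Literature.Geometry.Riemannian.BakryEmeryHeatFlow
import Literature.Geometry.Lorentzian.DalembertianCompose
import HarnessLib

/-!
# The integrated Bochner formula: `L²` Hessian bounds for harmonic functions from cut-offs

The mechanism behind the Hessian estimates of the Cheeger–Colding theory (Cheeger–Colding 1996,
§6, proof of Prop. 6.60; 2000, §1; Colding 1997, Lemma 2.x: "integrate the Bochner formula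
against a cut-off function with bounded Laplacian"): on a Riemannian manifold `(N, h)` with
`Ric ≥ K h`, for `u ∈ C^∞(N)` harmonic on a neighbourhood of the support of a cut-off
`φ ∈ C_c^∞(N)`, `φ ≥ 0`,

  `2 ∫ φ |Hess u|² dV ≤ ∫ (Δφ)(|∇u|² − c) dV − 2K ∫ φ |∇u|² dV`   for every constant `c`

(`two_mul_integral_mul_normSq_hessian_le`): pointwise Bochner
`Δ|∇u|² ≥ 2|Hess u|² + 2K|∇u|²` where `d(Δu) = 0`
(`dalembertian_gradSq_ge_hessian_of_mvfderiv_dalembertian_eq_zero`), Green's second identity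
`∫ φ Δ|∇u|² = ∫ (Δφ)|∇u|²` for compactly supported `φ`, and `∫ Δφ = 0`. With `|Δφ| ≤ Λ`,
`0 ≤ φ ≤ 1`, `φ = 1` on `B_R`, supported in `B_{2R}`, this is the Cheeger–Colding bound
`∫_{B_R} |Hess u|² ≤ (Λ/2) ∫_{B_{2R}} ||∇u|² − c| + |K| ∫_{B_{2R}} |∇u|²`.
§2 adds the Cauchy–Schwarz inequality `T(v,w)² ≤ |T|²_g g(v,v) g(w,w)` for the metric square norm
(`apply_sq_le_normSq_mul`) and the **Caccioppoli–Bochner bound**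
`∫ ψ²|Hess u|² ≤ 4∫|∇ψ|²|∇u|² − 2K∫ψ²|∇u|²` (`integral_sq_mul_normSq_hessian_le`), which needs
only gradient-bounded cut-offs (Gaffney's, `CompleteManifoldCutoff.lean`).

No definitions, no named facts (D-0026). Groundwork for `CheegerColding1997_sphereStability`.

## References

* J. Cheeger, T. H. Colding, Ann. of Math. 144 (1996) 189–237, §6. [CheegerColding1996]
* P. Petersen, *Riemannian Geometry*, 3rd ed. (2016), Lemma 8.2.1 (Bochner). [Petersen2016]
* J. M. Lee, *Introduction to Riemannian Manifolds* (2018), Problem 2-23 (Green). [Lee2018]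
-/

noncomputable section

open Bundle Set Function Filter Topology MeasureTheory
open scoped Manifold ContDiff ENNReal NNReal

namespace Literature.Geometry.Riemannian

open Literature.Geometry.Lorentzian
open Literature.Geometry.Lorentzian.PseudoRiemannianMetric

section Integrated

variable {m : ℕ} {H : Type*} [TopologicalSpace H]
  {I : ModelWithCorners ℝ (EuclideanSpace ℝ (Fin m)) H} [I.Boundaryless]
  {N : Type*} [TopologicalSpace N] [ChartedSpace H N] [IsManifold I ∞ N]
  [T2Space N] [LocallyCompactSpace N] [SigmaCompactSpace N] [MeasurableSpace N] [BorelSpace N]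
  (h : ContMDiffRiemannianMetric I ∞ (EuclideanSpace ℝ (Fin m)) (TangentSpace I : N → Type _))
  [(ofRiemannian h).HasLeviCivita]

/-- **Green's second identity for a compactly supported factor**: `∫ φ Δ_h F = ∫ F Δ_h φ` for
`φ ∈ C_c^∞(N)`... precisely `φ ∈ C²_c`, `F ∈ C²` (the first identity in both orders).
[cite: Lee2018, Problem 2-23 (a)] -/
theorem integral_mul_dalembertian_comm_of_hasCompactSupport {φ F : N → ℝ} (hφ : CMDiff 2 φ)
    (hφc : HasCompactSupport φ) (hF : CMDiff 2 F) :
    ∫ p, φ p * (ofRiemannian h).dalembertian F p ∂riemannianMeasure h =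
      ∫ p, F p * (ofRiemannian h).dalembertian φ p ∂riemannianMeasure h := by
  have hφ1 : CMDiff 1 φ := hφ.of_le (by norm_cast)
  have hF1 : CMDiff 1 F := hF.of_le (by norm_cast)
  rw [integral_mul_dalembertian_eq_neg_integral_innerDual_of_hasCompactSupport h hφ1 hφc hF,
    integral_mul_dalembertian_eq_neg_integral_innerDual_of_hasCompactSupport_right h hF1 hφ hφc]
  congr 1
  exact integral_congr_ae (Eventually.of_forall fun p ↦ (ofRiemannian h).innerDual_comm p _ _)

/-- **`∫ Δ_h φ = 0`** for `φ ∈ C²_c(N)` (Green with `F = 1`). [cite: Lee2018, Problem 2-23 (a)] -/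
theorem integral_dalembertian_eq_zero_of_hasCompactSupport {φ : N → ℝ} (hφ : CMDiff 2 φ)
    (hφc : HasCompactSupport φ) :
    ∫ p, (ofRiemannian h).dalembertian φ p ∂riemannianMeasure h = 0 := by
  have h1 := integral_mul_dalembertian_comm_of_hasCompactSupport h hφ hφc
    (F := fun _ ↦ (1 : ℝ)) contMDiff_const
  have h0 : ∀ p, (ofRiemannian h).dalembertian (fun _ : N ↦ (1 : ℝ)) p = 0 := fun p ↦ by
    have h2 := (ofRiemannian h).dalembertian_real_comp (u := fun _ : N ↦ (0 : ℝ)) (ζ := fun _ : ℝ ↦ (1 : ℝ))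
      (x := p) contMDiffAt_const contDiffAt_const
    simp only [deriv_const', deriv_const, zero_mul, add_zero] at h2
    exact h2
  simp only [h0, mul_zero, integral_zero, one_mul] at h1
  exact h1.symm

/-- **The integrated Bochner inequality** (Cheeger–Colding 1996, §6; Petersen 2016, 8.2.1
integrated): under `Ric ≥ K h`, for `u ∈ C^∞(N)` with `d(Δ_h u) = 0` on `tsupport φ` (e.g. `u`
harmonic on a neighbourhood of it), `φ ∈ C_c^∞(N)`, `φ ≥ 0`, and every constant `c`:
`2 ∫ φ |Hess u|²_h ≤ ∫ (Δ_h φ)(|∇u|²_h − c) − 2K ∫ φ |∇u|²_h`.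
[cite: CheegerColding1996, §6] [cite: Petersen2016, Lemma 8.2.1] -/
theorem two_mul_integral_mul_normSq_hessian_le {K : ℝ}
    (hRic : ∀ (x : N) (w : TangentSpace I x), K * (ofRiemannian h).val x w w ≤ (ofRiemannian h).ricci x w w)
    {u : N → ℝ} (hu : ContMDiff I 𝓘(ℝ, ℝ) ∞ u) {φ : N → ℝ} (hφ : ContMDiff I 𝓘(ℝ, ℝ) ∞ φ)
    (hφc : HasCompactSupport φ) (hφ0 : ∀ x, 0 ≤ φ x)
    (hharm : ∀ x ∈ tsupport φ, mvfderiv I ((ofRiemannian h).dalembertian u) x = 0) (c : ℝ) :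
    2 * ∫ x, φ x * (ofRiemannian h).normSq x ((ofRiemannian h).hessian u x) ∂riemannianMeasure h ≤
      (∫ x, (ofRiemannian h).dalembertian φ x * ((ofRiemannian h).gradSq u x - c) ∂riemannianMeasure h)
        - 2 * K * ∫ x, φ x * (ofRiemannian h).gradSq u x ∂riemannianMeasure h := by
  set g := ofRiemannian h with hg
  set μ : Measure N := riemannianMeasure h with hμ
  haveI : IsFiniteMeasureOnCompacts μ :=
    ⟨fun K hK ↦ riemannianVolume_lt_top_of_isCompact_holds h le_rfl hK⟩
  have hgr : g.IsRiemannian := isRiemannian_ofRiemannian h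
  -- smoothness of `|∇u|²` and of the Hessian square norm integrand
  have hG : ContMDiff I 𝓘(ℝ, ℝ) ∞ (g.gradSq u) := contMDiff_gradSq g hu
  have hG2 : CMDiff 2 (g.gradSq u) := hG.of_le (by norm_cast)
  have hφ2 : CMDiff 2 φ := hφ.of_le (by norm_cast)
  have hΔφc : Continuous (g.dalembertian φ) := continuous_dalembertian _ hφ2
  have hΔGc : Continuous (g.dalembertian (g.gradSq u)) := continuous_dalembertian _ hG2
  -- pointwise Bochner on `tsupport φ`, multiplied by `φ ≥ 0`
  have hpt : ∀ x, 2 * (φ x * g.normSq x (g.hessian u x)) + 2 * K * (φ x * g.gradSq u x) ≤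
      φ x * g.dalembertian (g.gradSq u) x := by
    intro x
    by_cases hx : x ∈ tsupport φ
    · have hB := dalembertian_gradSq_ge_hessian_of_mvfderiv_dalembertian_eq_zero g hRic hu (hharm x hx)
      have := mul_le_mul_of_nonneg_left hB (hφ0 x)
      nlinarith
    · rw [image_eq_zero_of_notMem_tsupport hx]; simp
  -- integrability (everything is `φ`- or `Δφ`-weighted, hence compactly supported)
  have hΔφs : HasCompactSupport (g.dalembertian φ) :=
    HasCompactSupport.intro hφc fun x hx ↦ dalembertian_eq_zero_of_notMem_tsupport _ hx
  have hHc : Continuous fun x ↦ φ x * g.normSq x (g.hessian u x) :=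
    hφ.continuous.mul (contMDiff_normSq_hessian g hu).continuous
  have hi1 : Integrable (fun x ↦ φ x * g.normSq x (g.hessian u x)) μ :=
    hHc.integrable_of_hasCompactSupport hφc.mul_right
  have hi2 : Integrable (fun x ↦ φ x * g.gradSq u x) μ :=
    (hφ.continuous.mul hG.continuous).integrable_of_hasCompactSupport hφc.mul_right
  have hi3 : Integrable (fun x ↦ φ x * g.dalembertian (g.gradSq u) x) μ :=
    (hφ.continuous.mul hΔGc).integrable_of_hasCompactSupport hφc.mul_right
  have hi4 : Integrable (fun x ↦ g.dalembertian φ x * (g.gradSq u x - c)) μ :=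
    (hΔφc.mul (hG.continuous.sub continuous_const)).integrable_of_hasCompactSupport hΔφs.mul_right
  -- integrate the pointwise inequality
  have hint : 2 * ∫ x, φ x * g.normSq x (g.hessian u x) ∂μ + 2 * K * ∫ x, φ x * g.gradSq u x ∂μ ≤
      ∫ x, φ x * g.dalembertian (g.gradSq u) x ∂μ := by
    rw [← integral_const_mul, ← integral_const_mul, ← integral_add ((hi1.const_mul 2)) (hi2.const_mul _)]
    exact integral_mono ((hi1.const_mul 2).add (hi2.const_mul _)) hi3 fun x ↦ hpt x
  -- Green's second identity and `∫ Δφ = 0`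
  have hgreen : ∫ x, φ x * g.dalembertian (g.gradSq u) x ∂μ =
      ∫ x, g.dalembertian φ x * (g.gradSq u x - c) ∂μ := by
    simp only [hμ, hg]
    rw [integral_mul_dalembertian_comm_of_hasCompactSupport h hφ2 hφc hG2]
    have h0 := integral_dalembertian_eq_zero_of_hasCompactSupport h hφ2 hφc
    have hi5 : Integrable (fun x ↦ (ofRiemannian h).gradSq u x * (ofRiemannian h).dalembertian φ x)
        (riemannianMeasure h) :=
      (hG.continuous.mul hΔφc).integrable_of_hasCompactSupport hΔφs.mul_left
    have hi6 : Integrable (fun x ↦ (ofRiemannian h).dalembertian φ x) (riemannianMeasure h) :=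
      hΔφc.integrable_of_hasCompactSupport hΔφs
    calc ∫ x, (ofRiemannian h).gradSq u x * (ofRiemannian h).dalembertian φ x ∂riemannianMeasure h
        = (∫ x, (ofRiemannian h).gradSq u x * (ofRiemannian h).dalembertian φ x ∂riemannianMeasure h)
            - c * ∫ x, (ofRiemannian h).dalembertian φ x ∂riemannianMeasure h := by rw [h0, mul_zero, sub_zero]
      _ = ∫ x, (ofRiemannian h).dalembertian φ x * ((ofRiemannian h).gradSq u x - c) ∂riemannianMeasure h := by
          rw [← integral_const_mul, ← integral_sub hi5 (hi6.const_mul c)]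
          exact integral_congr_ae (Eventually.of_forall fun x ↦ by ring)
  rw [hgreen] at hint
  linarith

end Integrated

/-! ### §2 Cauchy–Schwarz for the metric square norm, and the Caccioppoli–Bochner bound -/

section CauchySchwarz

variable {E : Type*} [NormedAddCommGroup E] [NormedSpace ℝ E] [FiniteDimensional ℝ E]
  {H : Type*} [TopologicalSpace H] {I : ModelWithCorners ℝ E H}
  {M : Type*} [TopologicalSpace M] [ChartedSpace H M] [IsManifold I ∞ M]
  (g : PseudoRiemannianMetric I ∞ E (TangentSpace I : M → Type _))

/-- **Cauchy–Schwarz for the metric square norm**: for a Riemannian `g`, a bilinear form `T` on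
`T_x M` and `v, w`: `T(v, w)² ≤ |T|²_g · g(v,v) · g(w,w)` (expand in a `g`-orthogonal frame,
`normSq_eq_sum_sq`, and apply the weighted Cauchy–Schwarz inequality on the index pairs).
[cite: ONeill1983, Ch. 3, pp. 60–61] -/
theorem apply_sq_le_normSq_mul (hg : g.IsRiemannian) (x : M) (T : LinearMap.BilinForm ℝ (TangentSpace I x))
    (v w : TangentSpace I x) :
    T v w ^ 2 ≤ g.normSq x T * g.val x v v * g.val x w w := by
  classical
  obtain ⟨e, he, hc⟩ := g.exists_isOrthoᵢ_basis x
  have hpos : ∀ i, 0 < g.val x (e i) (e i) := fun i ↦ hg x (e i) (e.ne_zero i)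
  set c : Fin (Module.finrank ℝ (TangentSpace I x)) → ℝ := fun i ↦ e.repr v i with hcdef
  set d : Fin (Module.finrank ℝ (TangentSpace I x)) → ℝ := fun i ↦ e.repr w i with hddef
  have hv : v = ∑ i, c i • e i := (e.sum_repr v).symm
  have hw : w = ∑ i, d i • e i := (e.sum_repr w).symm
  have hortho : ∀ i j, i ≠ j → g.val x (e i) (e j) = 0 := fun i j hij ↦ he hij
  -- expansions of `T(v, w)`, `g(v, v)`, `g(w, w)` in the frame
  have h1 : ∀ y, T v y = ∑ i, c i * T (e i) y := fun y ↦ by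
    rw [hv]; simp only [map_sum, map_smul, LinearMap.sum_apply, LinearMap.smul_apply, smul_eq_mul]
  have h2 : ∀ i, T (e i) w = ∑ j, d j * T (e i) (e j) := fun i ↦ by
    rw [hw]; simp only [map_sum, map_smul, smul_eq_mul]
  have hT : T v w = ∑ i, ∑ j, c i * d j * T (e i) (e j) := by
    rw [h1]
    refine Finset.sum_congr rfl fun i _ ↦ ?_
    rw [h2, Finset.mul_sum]
    exact Finset.sum_congr rfl fun j _ ↦ by ring
  have h3 : ∀ (a : Fin (Module.finrank ℝ (TangentSpace I x)) → ℝ) (z : TangentSpace I x),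
      z = ∑ i, a i • e i → g.val x z z = ∑ i, a i ^ 2 * g.val x (e i) (e i) := by
    intro a z hz
    have h4 : ∀ y, g.val x z y = ∑ i, a i * g.val x (e i) y := fun y ↦ by
      rw [hz]; simp only [map_sum, map_smul, FunLike.coe_sum, Finset.sum_apply, FunLike.coe_smul,
        Pi.smul_apply, smul_eq_mul]
    have h5 : ∀ i, g.val x (e i) z = a i * g.val x (e i) (e i) := fun i ↦ by
      rw [hz]; simp only [map_sum, map_smul, smul_eq_mul]
      rw [Finset.sum_eq_single i (fun j _ hji ↦ by rw [hortho i j (Ne.symm hji), mul_zero])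
        (fun h' ↦ absurd (Finset.mem_univ i) h')]
    rw [h4]
    exact Finset.sum_congr rfl fun i _ ↦ by rw [h5]; ring
  have hvv := h3 c v hv
  have hww := h3 d w hw
  have hN : g.normSq x T = ∑ i, ∑ j, T (e i) (e j) ^ 2 / (g.val x (e i) (e i) * g.val x (e j) (e j)) := by
    rw [g.normSq_eq_sum_sq x e he hc T, Finset.sum_comm]
    refine Finset.sum_congr rfl fun i _ ↦ Finset.sum_congr rfl fun j _ ↦ by rw [mul_comm]
  -- weighted Cauchy–Schwarz on index pairs
  rw [hT, hvv, hww, hN, mul_assoc, Finset.sum_mul_sum, ← Finset.sum_product', ← Finset.sum_product',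
    ← Finset.sum_product']
  refine Finset.sum_sq_le_sum_mul_sum_of_sq_le_mul _ (fun p _ ↦ ?_) (fun p _ ↦ ?_) (fun p _ ↦ ?_)
  · exact div_nonneg (sq_nonneg _) (mul_pos (hpos _) (hpos _)).le
  · exact mul_nonneg (mul_nonneg (sq_nonneg _) (hpos _).le) (mul_nonneg (sq_nonneg _) (hpos _).le)
  · have hp1 : 0 < g.val x (e p.1) (e p.1) := hpos _
    have hp2 : 0 < g.val x (e p.2) (e p.2) := hpos _
    rw [div_mul_eq_mul_div, le_div_iff₀ (mul_pos hp1 hp2)]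
    nlinarith [sq_nonneg (c p.1 * d p.2 * T (e p.1) (e p.2))]

end CauchySchwarz

section Caccioppoli

variable {m : ℕ} {H : Type*} [TopologicalSpace H]
  {I : ModelWithCorners ℝ (EuclideanSpace ℝ (Fin m)) H} [I.Boundaryless]
  {N : Type*} [TopologicalSpace N] [ChartedSpace H N] [IsManifold I ∞ N]
  [T2Space N] [LocallyCompactSpace N] [SigmaCompactSpace N] [MeasurableSpace N] [BorelSpace N]
  (h : ContMDiffRiemannianMetric I ∞ (EuclideanSpace ℝ (Fin m)) (TangentSpace I : N → Type _))
  [(ofRiemannian h).HasLeviCivita]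

/-- **The Caccioppoli–Bochner `L²` Hessian bound** (Cheeger–Colding 1996, §6; the form needing
only gradient-bounded cut-offs): under `Ric ≥ K h`, for `u ∈ C^∞(N)` with `d(Δ_h u) = 0` on
`tsupport ψ`, `ψ ∈ C_c^∞(N)`:
`∫ ψ² |Hess u|²_h ≤ 4 ∫ |∇ψ|²_h |∇u|²_h − 2K ∫ ψ² |∇u|²_h`
(pointwise Bochner against `φ = ψ²`, Green `∫ ψ² Δ|∇u|² = -∫ h⁻¹(d(ψ²), d|∇u|²)`,
`d|∇u|²(X) = 2 Hess u(X, ∇u)`, Cauchy–Schwarz and `4ab ≤ a² + 4b²`).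
[cite: CheegerColding1996, §6] [cite: Petersen2016, Lemma 8.2.1] -/
theorem integral_sq_mul_normSq_hessian_le {K : ℝ}
    (hRic : ∀ (x : N) (w : TangentSpace I x), K * (ofRiemannian h).val x w w ≤ (ofRiemannian h).ricci x w w)
    {u : N → ℝ} (hu : ContMDiff I 𝓘(ℝ, ℝ) ∞ u) {ψ : N → ℝ} (hψ : ContMDiff I 𝓘(ℝ, ℝ) ∞ ψ)
    (hψc : HasCompactSupport ψ)
    (hharm : ∀ x ∈ tsupport ψ, mvfderiv I ((ofRiemannian h).dalembertian u) x = 0) :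
    ∫ x, ψ x ^ 2 * (ofRiemannian h).normSq x ((ofRiemannian h).hessian u x) ∂riemannianMeasure h ≤
      4 * (∫ x, (ofRiemannian h).gradSq ψ x * (ofRiemannian h).gradSq u x ∂riemannianMeasure h)
        - 2 * K * ∫ x, ψ x ^ 2 * (ofRiemannian h).gradSq u x ∂riemannianMeasure h := by
  set g := ofRiemannian h with hg
  set μ : Measure N := riemannianMeasure h with hμ
  haveI : IsFiniteMeasureOnCompacts μ :=
    ⟨fun K hK ↦ riemannianVolume_lt_top_of_isCompact_holds h le_rfl hK⟩
  have hgr : g.IsRiemannian := isRiemannian_ofRiemannian h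
  have hG : ContMDiff I 𝓘(ℝ, ℝ) ∞ (g.gradSq u) := contMDiff_gradSq g hu
  have hG2 : CMDiff 2 (g.gradSq u) := hG.of_le (by norm_cast)
  have hψ2s : ContMDiff I 𝓘(ℝ, ℝ) ∞ (fun x ↦ ψ x ^ 2) := hψ.pow 2
  have hψ2c : HasCompactSupport (fun x ↦ ψ x ^ 2) :=
    HasCompactSupport.intro hψc fun x hx ↦ by rw [image_eq_zero_of_notMem_tsupport hx]; ring
  have htsψ2 : tsupport (fun x ↦ ψ x ^ 2) ⊆ tsupport ψ :=
    closure_mono fun x hx ↦ by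
      rw [mem_support] at hx ⊢
      exact fun h0 ↦ hx (by rw [h0]; ring)
  have hψ1 : CMDiff 1 ψ := hψ.of_le (by norm_cast)
  have hψ21 : CMDiff 1 (fun x ↦ ψ x ^ 2) := hψ2s.of_le (by norm_cast)
  have hu1 : CMDiff 1 u := hu.of_le (by norm_cast)
  have hG1 : CMDiff 1 (g.gradSq u) := hG.of_le (by norm_cast)
  have hΔGc : Continuous (g.dalembertian (g.gradSq u)) := continuous_dalembertian _ hG2
  -- pointwise Bochner against `ψ²`
  have hpt : ∀ x, 2 * (ψ x ^ 2 * g.normSq x (g.hessian u x)) + 2 * K * (ψ x ^ 2 * g.gradSq u x) ≤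
      ψ x ^ 2 * g.dalembertian (g.gradSq u) x := by
    intro x
    by_cases hx : x ∈ tsupport ψ
    · have hB := dalembertian_gradSq_ge_hessian_of_mvfderiv_dalembertian_eq_zero g hRic hu (hharm x hx)
      have := mul_le_mul_of_nonneg_left hB (sq_nonneg (ψ x))
      nlinarith
    · rw [image_eq_zero_of_notMem_tsupport hx]; simp
  -- Green: `∫ ψ² Δ|∇u|² = -∫ h⁻¹(d(ψ²), d|∇u|²)`
  have hgreen := integral_mul_dalembertian_eq_neg_integral_innerDual_of_hasCompactSupport h hψ21 hψ2c hG2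
  -- the first-order term pointwise: `h⁻¹(d(ψ²), d|∇u|²) = 4 ψ Hess u(♯dψ, ∇u)` and its bound
  have hfirst : ∀ x, -(g.innerDual x (mvfderiv I (fun x ↦ ψ x ^ 2) x).toLinearMap
      (mvfderiv I (g.gradSq u) x).toLinearMap) ≤
      ψ x ^ 2 * g.normSq x (g.hessian u x) + 4 * (g.gradSq ψ x * g.gradSq u x) := by
    intro x
    have hdψ : MDiffAt ψ x := (hψ1 x).mdifferentiableAt one_ne_zero
    -- `d(ψ²) = 2ψ dψ`
    have hd2 : mvfderiv I (fun x ↦ ψ x ^ 2) x = (2 * ψ x) • mvfderiv I ψ x := by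
      have := mvfderiv_fun_mul hdψ hdψ
      rw [show (fun x ↦ ψ x ^ 2) = fun x ↦ ψ x * ψ x from funext fun x ↦ sq (ψ x), this]
      ext v'
      simp only [FunLike.coe_add, Pi.add_apply, FunLike.coe_smul, Pi.smul_apply, smul_eq_mul]
      ring
    -- `h⁻¹(α, d|∇u|²) = d|∇u|²(♯α) = 2 Hess u(♯α, ∇u)`
    set α : Module.Dual ℝ (TangentSpace I x) := (mvfderiv I ψ x).toLinearMap with hα
    set Xψ : TangentSpace I x := g.sharp x α with hX
    set Xu : TangentSpace I x := g.sharp x (mvfderiv I u x).toLinearMap with hXu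
    have hinner : g.innerDual x (mvfderiv I (fun x ↦ ψ x ^ 2) x).toLinearMap
        (mvfderiv I (g.gradSq u) x).toLinearMap = 2 * ψ x * (2 * g.hessian u x Xψ Xu) := by
      have h1 : g.innerDual x (mvfderiv I (fun x ↦ ψ x ^ 2) x).toLinearMap
          (mvfderiv I (g.gradSq u) x).toLinearMap =
          2 * ψ x * g.innerDual x α (mvfderiv I (g.gradSq u) x).toLinearMap := by
        rw [hd2]
        simp only [PseudoRiemannianMetric.innerDual, ContinuousLinearMap.toLinearMap_smul,
          LinearMap.smul_apply, smul_eq_mul, hα]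
      have h2 : g.innerDual x α (mvfderiv I (g.gradSq u) x).toLinearMap =
          mvfderiv I (g.gradSq u) x Xψ := by
        rw [innerDual_comm]; rfl
      rw [h1, h2, mvfderiv_gradSq_apply g hu x Xψ]
    -- Cauchy–Schwarz: `|Hess u(Xψ, Xu)| ≤ √|Hess|² √|∇ψ|² √|∇u|²`
    have hCS := apply_sq_le_normSq_mul g hgr x (g.hessian u x) Xψ Xu
    have hXψ : g.val x Xψ Xψ = g.gradSq ψ x := by
      rw [hX, hα, ← innerDual_eq_val_sharp_sharp]; rfl
    have hXu' : g.val x Xu Xu = g.gradSq u x := by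
      rw [hXu, ← innerDual_eq_val_sharp_sharp]; rfl
    rw [hXψ, hXu'] at hCS
    rw [hinner]
    -- `-4ψ H ≤ ψ² N + 4 PQ` where `H² ≤ N P Q`: `(4ψH)² ≤ 16 ψ² N P Q ≤ (ψ²N + 4PQ)²`
    set Nn := g.normSq x (g.hessian u x) with hNn
    set P := g.gradSq ψ x with hP
    set Q := g.gradSq u x with hQ
    set Hh := g.hessian u x Xψ Xu with hHh
    have hN0 : 0 ≤ Nn := g.normSq_nonneg x hgr _
    have hP0 : 0 ≤ P := g.gradSq_nonneg hgr ψ x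
    have hQ0 : 0 ≤ Q := g.gradSq_nonneg hgr u x
    have h16 : (4 * ψ x * Hh) ^ 2 ≤ 16 * ψ x ^ 2 * (Nn * P * Q) := by
      have := mul_le_mul_of_nonneg_left hCS (by positivity : (0 : ℝ) ≤ 16 * ψ x ^ 2)
      nlinarith
    have hsq : (4 * ψ x * Hh) ^ 2 ≤ (ψ x ^ 2 * Nn + 4 * (P * Q)) ^ 2 := by
      nlinarith [sq_nonneg (ψ x ^ 2 * Nn - 4 * (P * Q))]
    have habs : |4 * ψ x * Hh| ≤ ψ x ^ 2 * Nn + 4 * (P * Q) :=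
      abs_le_of_sq_le_sq hsq (by positivity)
    have := neg_le_abs (4 * ψ x * Hh)
    have e : 2 * ψ x * (2 * Hh) = 4 * ψ x * Hh := by ring
    rw [e]
    linarith
  -- integrability of all terms (compactly supported continuous functions)
  have hNc : Continuous fun x ↦ ψ x ^ 2 * g.normSq x (g.hessian u x) :=
    (hψ.continuous.pow 2).mul (contMDiff_normSq_hessian g hu).continuous
  have hi1 : Integrable (fun x ↦ ψ x ^ 2 * g.normSq x (g.hessian u x)) μ :=
    hNc.integrable_of_hasCompactSupport hψ2c.mul_right
  have hi2 : Integrable (fun x ↦ ψ x ^ 2 * g.gradSq u x) μ :=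
    ((hψ.continuous.pow 2).mul hG.continuous).integrable_of_hasCompactSupport hψ2c.mul_right
  have hi3 : Integrable (fun x ↦ ψ x ^ 2 * g.dalembertian (g.gradSq u) x) μ :=
    ((hψ.continuous.pow 2).mul hΔGc).integrable_of_hasCompactSupport hψ2c.mul_right
  have hPc : Continuous (g.gradSq ψ) := (contMDiff_gradSq g hψ).continuous
  have hPs : HasCompactSupport (g.gradSq ψ) :=
    HasCompactSupport.intro hψc fun x hx ↦ by
      simp [PseudoRiemannianMetric.gradSq, PseudoRiemannianMetric.innerDual,
        mvfderiv_eq_zero_of_notMem_tsupport hx]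
  have hi4 : Integrable (fun x ↦ g.gradSq ψ x * g.gradSq u x) μ :=
    (hPc.mul hG.continuous).integrable_of_hasCompactSupport hPs.mul_right
  have hIc : Continuous fun x ↦ g.innerDual x (mvfderiv I (fun x ↦ ψ x ^ 2) x).toLinearMap
      (mvfderiv I (g.gradSq u) x).toLinearMap := continuous_innerDual_mvfderiv _ hψ21 hG1
  have hIs : HasCompactSupport fun x ↦ g.innerDual x (mvfderiv I (fun x ↦ ψ x ^ 2) x).toLinearMap
      (mvfderiv I (g.gradSq u) x).toLinearMap := by
    refine HasCompactSupport.intro hψ2c fun x hx ↦ ?_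
    simp [PseudoRiemannianMetric.innerDual, mvfderiv_eq_zero_of_notMem_tsupport hx]
  have hi5 : Integrable (fun x ↦ g.innerDual x (mvfderiv I (fun x ↦ ψ x ^ 2) x).toLinearMap
      (mvfderiv I (g.gradSq u) x).toLinearMap) μ := hIc.integrable_of_hasCompactSupport hIs
  -- integrate
  have hA : 2 * ∫ x, ψ x ^ 2 * g.normSq x (g.hessian u x) ∂μ + 2 * K * ∫ x, ψ x ^ 2 * g.gradSq u x ∂μ ≤
      ∫ x, ψ x ^ 2 * g.dalembertian (g.gradSq u) x ∂μ := by
    rw [← integral_const_mul, ← integral_const_mul, ← integral_add ((hi1.const_mul 2)) (hi2.const_mul _)]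
    exact integral_mono ((hi1.const_mul 2).add (hi2.const_mul _)) hi3 fun x ↦ hpt x
  have hB : ∫ x, ψ x ^ 2 * g.dalembertian (g.gradSq u) x ∂μ ≤
      (∫ x, ψ x ^ 2 * g.normSq x (g.hessian u x) ∂μ) + 4 * ∫ x, g.gradSq ψ x * g.gradSq u x ∂μ := by
    have e1 : ∫ x, ψ x ^ 2 * g.dalembertian (g.gradSq u) x ∂μ =
        ∫ x, -(g.innerDual x (mvfderiv I (fun x ↦ ψ x ^ 2) x).toLinearMap
          (mvfderiv I (g.gradSq u) x).toLinearMap) ∂μ := by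
      rw [integral_neg]; exact hgreen
    rw [e1, ← integral_const_mul, ← integral_add hi1 (hi4.const_mul 4)]
    exact integral_mono hi5.neg (hi1.add (hi4.const_mul 4)) fun x ↦ by
      have := hfirst x
      simpa [mul_comm, mul_left_comm, mul_assoc] using this
  linarith
end Caccioppoli

end Literature.Geometry.Riemannian

end
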